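import Summits.NavierStokesRegularity.NavierStokesRegularity.Theses.HodographBetchov
import Literature.Analysis.FluidPDE.TaoLocalisationHolds
import Literature.Analysis.FluidPDE.TaoLocalisationProofs

/-!
# `FastClassSqueeze` (stmt-NavierStokesRegularity-15832): the content is the blow-up scenario

Route `HodographBetchov`, crux 3 (`FastClassSqueeze`): along every classical solution of unforced
Navier–Stokes on `ℝ³ × [0,T)` that is Leray–Hopf from a rapidly decaying datum there are a speed
level `l > 0`, an exponent `q > 3/2` and a nonnegative min–max majorant `m` of the middle strain
eigenvalue on the fast class `{|u| > l}` with `∫₀ᵀ (∫_{|u|>l} m^q)^{2/(2q−3)} < ∞`.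

Three supporting theorems (positive side, no Theses statement is asserted):

* `conclusion_of_bounded` — for ANY field `u` bounded by `L` on `[0,T) × ℝ³` the conclusion of the
  crux holds with `l = max L 0 + 1`, `q = 2`, `m ≡ 0`: the fast class is empty, so the min–max clause
  is vacuous and the mixed norm is `∫₀ᵀ 0² = 0`.
* `bounded_of_hasSmoothExtensionPast` — a classical solution on `[0,T)` that is Leray–Hopf from a
  rapidly decaying datum and extends classically past `T` is bounded on `[0,T) × ℝ³`: the extension
  is classical on the CLOSED slab `[0,T]`, has energy `≤ 2E(u₀)` there (Leray–Hopf energy inequality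
  for `t < T`, Fatou at `t = T` along the pointwise limit), hence bounded Sobolev norms of all orders
  (Tao 2013, Cor. 11.1 + Cor. 4.3 + Thm. 5.4 (iv): `tao2011_hasBoundedSobolevNormsOn_holds`) and a
  uniform bound by the Sobolev imbedding `H² ⊂ C_B` (`linfty_bound_of_hasBoundedSobolevNormsOn_holds`).
* `fastClassSqueeze_of_noBlowup` — consequently the crux FOLLOWS from the no-blow-up statement
  (every such solution extends classically past `T`, the `NoBlowup` packaging of Clay (A)): the crux
  is a necessary condition for regularity, and its whole content sits in the (unknown) first-time
  blow-up scenario `T = T_max` (refuter crux-attack note 2026-08-17).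
-/

noncomputable section

-- the summit and its single problem share the name `NavierStokesRegularity` (D-0017 nested layout)
set_option linter.dupNamespace false

namespace Summit.NavierStokesRegularity.NavierStokesRegularity.Theorems.FastClassSqueeze

open Set MeasureTheory Filter Topology Literature.Analysis.FluidPDE
open scoped ENNReal NNReal

/-- **The conclusion of `FastClassSqueeze` is trivial for a bounded field.** If `‖u t x‖ ≤ L` on
`[0,T) × ℝ³` then, with `l = max L 0 + 1`, `q = 2` and `m ≡ 0`, the fast class `{|u(t)| > l}` is
empty for every `t ∈ [0,T)`, the min–max clause is vacuous and the mixed norm vanishes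
(`∫₀ᵀ (∫ 0²)² = 0 < ∞`). No equation is used. [folklore] -/
theorem conclusion_of_bounded :
    ∀ (T : ℝ) (u : ℝ → EuclideanSpace ℝ (Fin 3) → EuclideanSpace ℝ (Fin 3)) (L : ℝ),
      (∀ t ∈ Set.Ico 0 T, ∀ x, ‖u t x‖ ≤ L) →
      ∃ l : ℝ, 0 < l ∧ ∃ q : ℝ, 3 / 2 < q ∧ ∃ m : ℝ → EuclideanSpace ℝ (Fin 3) → ℝ,
        (∀ t x, 0 ≤ m t x) ∧
        (∀ t ∈ Set.Ico 0 T, ∀ x, l < ‖u t x‖ → ∃ v w : EuclideanSpace ℝ (Fin 3),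
          ‖v‖ = 1 ∧ ‖w‖ = 1 ∧ inner ℝ v w = 0 ∧
          ∀ α β : ℝ, inner ℝ (fderiv ℝ (u t) x (α • v + β • w)) (α • v + β • w) ≤
            m t x * (α ^ 2 + β ^ 2)) ∧
        ∫⁻ t in Set.Ioo 0 T, (∫⁻ x in {x : EuclideanSpace ℝ (Fin 3) | l < ‖u t x‖},
          ENNReal.ofReal (m t x) ^ q) ^ (2 / (2 * q - 3)) < ⊤ := by
  intro T u L hL
  refine ⟨max L 0 + 1, by positivity, 2, by norm_num, fun _ _ => 0, fun _ _ => le_rfl, ?_, ?_⟩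
  · intro t ht x hx
    exact absurd (((hL t ht x).trans (le_max_left L 0)).trans_lt (lt_add_one _)) (not_lt.2 hx.le)
  · have h2 : (0 : ℝ) < 2 := two_pos
    have hexp : (0 : ℝ) < 2 / (2 * 2 - 3) := by norm_num
    simp only [ENNReal.ofReal_zero, ENNReal.zero_rpow_of_pos h2, lintegral_const, zero_mul,
      ENNReal.zero_rpow_of_pos hexp]
    exact ENNReal.zero_lt_top

/-- **A classical Leray–Hopf solution that extends classically past `T` is bounded on `[0,T) × ℝ³`.**
Let `(u,p)` be classical on `[0,T)`, Leray–Hopf on `[0,T)` from the rapidly decaying datum `u 0`, and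
let `(u',p')` be a classical extension to `[0,T')`, `T' > T`, with `u' = u` on `[0,T)`. Then `u'` is
classical on the closed slab `[0,T]`; its energy is `≤ 2E(u 0)` for `t < T` (energy inequality) and
at `t = T` by Fatou (`u'(t,x) → u'(T,x)` pointwise as `t ↑ T`); so Tao's persistence of regularity
(Tao 2013, Cor. 11.1 + Cor. 4.3 + Thm. 5.4 (iv)) bounds all Sobolev norms on `[0,T]` and the Sobolev
imbedding bounds `u'`, hence `u`, uniformly. [cite: Tao2011, Cor. 11.1 + Cor. 4.3 + Thm. 5.4 (iv)] -/
theorem bounded_of_hasSmoothExtensionPast :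
    ∀ (ν T : ℝ), 0 < ν → 0 < T →
      ∀ (u : ℝ → EuclideanSpace ℝ (Fin 3) → EuclideanSpace ℝ (Fin 3))
        (p : ℝ → EuclideanSpace ℝ (Fin 3) → ℝ),
        Literature.Analysis.FluidPDE.IsClassicalNSSolutionOn (Set.Ico 0 T) ν 0 u p →
        Literature.Analysis.FluidPDE.IsLerayHopfOn T ν 0 (u 0) u →
        Literature.Analysis.FluidPDE.HasRapidSpatialDecay (u 0) →
        Literature.Analysis.FluidPDE.HasSmoothExtensionPast ν 0 u T →
        ∃ M : ℝ, ∀ t ∈ Set.Ico 0 T, ∀ x, ‖u t x‖ ≤ M := by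
  intro ν T hν hT u p _hcl hLH hdec hext
  obtain ⟨T', hT', u', p', hcl', hagree⟩ := hext
  -- the extension on the closed slab `[0,T]`
  have hUD : UniqueDiffOn ℝ (Icc 0 T) := uniqueDiffOn_Icc hT
  have hsol : IsClassicalNSSolutionOn (Icc 0 T) ν 0 u' p' :=
    hcl'.mono (Icc_subset_Ico_right hT') hUD
  -- energy bound `2 E(u 0)` on `[0,T)` transported to `u'`
  set E₀ : ℝ≥0∞ := ENNReal.ofReal (2 * VectorCalculus.kineticEnergy (u 0)) with hE₀
  have hEt : ∀ t ∈ Ico 0 T, ∫⁻ x, ‖u' t x‖ₑ ^ 2 ≤ E₀ := by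
    intro t ht
    rw [hagree t ht]
    exact hLH.lintegral_enorm_sq_le hν.le ⟨ht.1, ht.2.le⟩
  -- energy bound at `t = T` by Fatou along `tₙ ↑ T`
  have hET : ∫⁻ x, ‖u' T x‖ₑ ^ 2 ≤ E₀ := by
    -- a sequence `tₙ ∈ (0,T)` increasing to `T`
    set s : ℕ → ℝ := fun n => T - T / ((n : ℝ) + 2) with hs
    have hs_mem : ∀ n, s n ∈ Ico 0 T := by
      intro n
      have hn2 : (0 : ℝ) < (n : ℝ) + 2 := by positivity
      have h1 : T / ((n : ℝ) + 2) ≤ T / 2 := by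
        apply div_le_div_of_nonneg_left hT.le two_pos
        linarith [(Nat.cast_nonneg n : (0 : ℝ) ≤ n)]
      have h2 : 0 < T / ((n : ℝ) + 2) := div_pos hT hn2
      constructor
      · rw [hs]; dsimp only; linarith
      · rw [hs]; dsimp only; linarith
    have hs_tend : Tendsto s atTop (𝓝 T) := by
      have h1 : Tendsto (fun n : ℕ => T / ((n : ℝ) + 2)) atTop (𝓝 0) := by
        have h2 : Tendsto (fun n : ℕ => (n : ℝ) + 2) atTop atTop :=
          tendsto_atTop_add_const_right _ _ tendsto_natCast_atTop_atTop
        exact h2.const_div_atTop T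
      have := tendsto_const_nhds (x := T) |>.sub h1
      simpa [hs] using this
    -- pointwise convergence `u' (s n) x → u' T x` from joint continuity on `[0,T'] × ℝ³`
    have hcont : ContinuousOn (Function.uncurry u') (Ico 0 T' ×ˢ univ) :=
      hcl'.smooth_velocity.continuousOn
    have hptw : ∀ x, Tendsto (fun n => u' (s n) x) atTop (𝓝 (u' T x)) := by
      intro x
      have hTx : (T, x) ∈ Ico 0 T' ×ˢ (univ : Set (EuclideanSpace ℝ (Fin 3))) := ⟨⟨hT.le, hT'⟩, mem_univ _⟩
      have hc := hcont (T, x) hTx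
      have hseq : Tendsto (fun n => (s n, x)) atTop (𝓝[Ico 0 T' ×ˢ univ] (T, x)) := by
        refine tendsto_nhdsWithin_iff.2 ⟨?_, Eventually.of_forall fun n => ?_⟩
        · exact (hs_tend.prodMk_nhds tendsto_const_nhds)
        · exact ⟨⟨(hs_mem n).1, (hs_mem n).2.trans hT'⟩, mem_univ _⟩
      exact hc.tendsto.comp hseq
    have hlim : ∀ x, ‖u' T x‖ₑ ^ 2 = liminf (fun n => ‖u' (s n) x‖ₑ ^ 2) atTop := by
      intro x
      have ht : Tendsto (fun n => ‖u' (s n) x‖ₑ ^ 2) atTop (𝓝 (‖u' T x‖ₑ ^ 2)) :=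
        ((ENNReal.continuous_pow 2).tendsto _).comp (hptw x).enorm
      exact ht.liminf_eq.symm
    have hmeas : ∀ n, AEMeasurable (fun x => ‖u' (s n) x‖ₑ ^ 2) volume := by
      intro n
      have hc : Continuous (u' (s n)) :=
        (hcl'.contDiff_velocity ⟨(hs_mem n).1, (hs_mem n).2.trans hT'⟩).continuous
      exact (hc.measurable.enorm.pow_const 2).aemeasurable
    calc ∫⁻ x, ‖u' T x‖ₑ ^ 2 = ∫⁻ x, liminf (fun n => ‖u' (s n) x‖ₑ ^ 2) atTop :=
          lintegral_congr fun x => hlim x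
      _ ≤ liminf (fun n => ∫⁻ x, ‖u' (s n) x‖ₑ ^ 2) atTop := lintegral_liminf_le' hmeas
      _ ≤ E₀ := by
          refine liminf_le_of_frequently_le' (Frequently.of_forall fun n => ?_)
          exact hEt (s n) (hs_mem n)
  have hE : ∃ C : ℝ≥0, ∀ t ∈ Icc 0 T, ∫⁻ x, ‖u' t x‖ₑ ^ 2 ≤ C := by
    refine ⟨E₀.toNNReal, fun t ht => ?_⟩
    rw [ENNReal.coe_toNNReal (by rw [hE₀]; exact ENNReal.ofReal_ne_top)]
    rcases ht.2.lt_or_eq with hlt | heq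
    · exact hEt t ⟨ht.1, hlt⟩
    · rw [heq]; exact hET
  -- the datum of the extension is the rapidly decaying `u 0`
  have hdec' : HasRapidSpatialDecay (u' 0) := by
    rw [hagree 0 ⟨le_rfl, hT⟩]
    exact hdec
  -- Tao: bounded Sobolev norms on `[0,T]`; Sobolev imbedding: uniform bound
  have hH : HasBoundedSobolevNormsOn (Icc 0 T) u' :=
    tao2011_hasBoundedSobolevNormsOn_holds hν hT hsol hE hdec'
  obtain ⟨C, hC⟩ := linfty_bound_of_hasBoundedSobolevNormsOn_holds
    (fun t ht => (hsol.contDiff_velocity ht).of_le (by norm_cast)) hH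
  refine ⟨C, fun t ht x => ?_⟩
  rw [← hagree t ht]
  exact hC t (Ico_subset_Icc_self ht) x

/-- **`FastClassSqueeze` follows from no blow-up.** If every classical solution of unforced
Navier–Stokes on `ℝ³ × [0,T)` that is Leray–Hopf from a rapidly decaying datum extends classically
past `T` (the `NoBlowup` packaging of Clay (A)), then `FastClassSqueeze` holds: such a solution is
bounded on `[0,T) × ℝ³` (`bounded_of_hasSmoothExtensionPast`), and for a bounded field the
conclusion is trivial (`conclusion_of_bounded`). So the crux is a necessary condition for
regularity and its content is the first-time blow-up scenario. [folklore] -/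
theorem fastClassSqueeze_of_noBlowup :
    (∀ (ν T : ℝ), 0 < ν → 0 < T →
      ∀ (u : ℝ → EuclideanSpace ℝ (Fin 3) → EuclideanSpace ℝ (Fin 3))
        (p : ℝ → EuclideanSpace ℝ (Fin 3) → ℝ),
        Literature.Analysis.FluidPDE.IsClassicalNSSolutionOn (Set.Ico 0 T) ν 0 u p →
        Literature.Analysis.FluidPDE.IsLerayHopfOn T ν 0 (u 0) u →
        Literature.Analysis.FluidPDE.HasRapidSpatialDecay (u 0) →
        Literature.Analysis.FluidPDE.HasSmoothExtensionPast ν 0 u T) →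
    Summit.NavierStokesRegularity.NavierStokesRegularity.Theses.HodographBetchov.FastClassSqueeze := by
  intro hNB ν T hν hT u p hcl hLH hdec
  obtain ⟨M, hM⟩ :=
    bounded_of_hasSmoothExtensionPast ν T hν hT u p hcl hLH hdec (hNB ν T hν hT u p hcl hLH hdec)
  exact conclusion_of_bounded T u M hM

end Summit.NavierStokesRegularity.NavierStokesRegularity.Theorems.FastClassSqueeze

end
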